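/-
Origin: expansion seat `prover-pub-hodgecm-mc-binder-2-g14-0`, handover #S8 2026-08-20T12:17Z md5 0bc964e1ad01 (PKG 04d22aa8f9a7 → 0bc964e1ad01; 163 l.; σ implicit; `hdense_of_polys` over `printedAtσ … σ`; proof verbatim) (`HOME/mc/pub-hodgecm-mc-binder-2/g14/s5b/HodgeCM/Model/HypCensus/DenseReduce.lean`, md5 0bc964e1ad01, 163 lines);
landed by the gen-20 packager (p-g20) in gate run 51 REPLACES the earlier landed copy of `HodgeCM/Model/HypCensus/DenseReduce.lean` (seat copy carried the packager Origin header of an earlier run (stripped)).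
-/
/-
Copyright (c) 2026. All rights reserved.
Released under Apache 2.0 license as described in the file LICENSE.
-/
import Summits.HodgeConjecture.HodgeCM.Model.HypCensus.DensePin
import Summits.HodgeConjecture.HodgeCM.Model.HypCensus.SideWAssembly

/-!
# (J-dense), step (v): the census field `dense` REDUCED to the isotypic polynomials

Binder-2 lineage, rows 18/19 (`hyp12`/`hyp34`), field `dense` of `HypCoreW` — the residual `hdense` of #55/#56.

Closure bookkeeping assembling #57 (`SK = 𝒮_∞^κ ⊗ 𝒮_f`, finite sums), #59 (`𝒮_∞^κ = closure span (follandFock '' pinIsotypicPolys)`)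
and (J-top) #7 (`Φ_∞ ↦ toTop E(Φ_∞ ⊗ f)` continuous into Weil's `Θ`-initial topology):

* `dense_val_of_polys` (value currency, any `Γ`): if for every isotypic polynomial `G ∈ pinIsotypicPolys` and every
  `f ∈ 𝒮(𝔸_f^6)` the vector `toTop E(follandFock 𝔢 G ⊗ f)` lies in the `Θ`-closure of `toTop '' span {ins f φ}`, then so does
  `toTop Φ` for EVERY `Φ ∈ W₀.SK`;
* `hdense_of_polys`: the same in the currency of #55's hypothesis `hdense` (the W pin of record, `printedAt V S hW jD m₁ m₂`).

So rows 18/19's `hdense` ⟸ `hpoly : ∀ G ∈ pinIsotypicPolys, ∀ f, toTop E(follandFock 𝔢 G ⊗ f) ∈ closure (toTop '' span {ins f φ})`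
— in particular ⟸ the ALGEBRAIC statement `pinIsotypicPolys ⊆ range insPoly` ((J-dense) step (iv), per-place classification).
[cite: Folland1989, Ch. 4 §5; Weil1964, Chap. III n° 41]

**(T12)/(B1′) second table.** RULING S5b (B1′) re-base: `hdense_of_polys` is stated for the census `datumAtσ … σ`, `σ` IMPLICIT (`σ = 1` = the statement of record).
-/

noncomputable section

open NumberField NumberField.InfinitePlace IsDedekindDomain
open scoped Matrix Classical TensorProduct
open MvPolynomial
open Literature.NumberTheory.Automorphic Literature.NumberTheory.Automorphic.UnitaryGroup Literature.NumberTheory.Weil1964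
open Literature.RepresentationTheory.KonnoKonno2007 Literature.RepresentationTheory.KonnoKonno2007.RealDualPair
open Literature.NumberTheory.GelbartRogawski1991 Literature.NumberTheory.GelbartRogawski1991.UnitaryDualPair
open Literature.Analysis.SegalBargmann
open HodgeCM HodgeCM.Model HodgeCM.Adelic
open HodgeCM.PerL34.Fock HodgeCM.PerL34.Fock.PrintDict

namespace HodgeCM.Model.HypCensus

section Val

variable {L : CMField} {ι₁ : L →+* ℂ} (V : HermSpace3 L ι₁) (S : StubTree.SeesawDatum L)
variable
  (hGR : (cmSplittingDatum (L : Type) finProdFinEquiv (frameD V) (frameD_real V) (frameD_ne V) (dW S) (dW_real S) (dW_ne S)).CompatibleSplitting)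
  (η : CMAdelic (L : Type) (frameD V) × CMAdelic (L : Type) (dW S) →* ℂˣ)
  (hη : ∀ γU ∈ CMRat (L : Type) (frameD V), ∀ γ ∈ CMRat (L : Type) (dW S), η (γU, γ) = 1)
  (hηc : Continuous fun p => ((η p : ℂˣ) : ℂ))
  (hW : (∀ j, 0 < (ι₁ (dW S j)).re) ∨ ∀ j, (ι₁ (dW S j)).re < 0)

include hηc hW in
/-- **`dense` from the isotypic polynomials, value currency.**  `D = pinThetaDatum V S hGR η Γ` (Weil's `Θ`-initial topology of
`ρ_η`), `M` any submodule of `𝒮(𝔸^6)` (the span of the inserted printed vectors): if `toTop E(follandFock 𝔢 G ⊗ f) ∈ closure (toTop '' M)`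
for all `G ∈ pinIsotypicPolys`, `f ∈ 𝒮(𝔸_f^6)`, then `toTop Φ ∈ closure (toTop '' M)` for every `Φ ∈ W₀.SK`. -/
theorem dense_val_of_polys (Γ : Set (CMAdelic (L : Type) (frameD V) × CMAdelic (L : Type) (dW S)))
    (M : Submodule ℂ (CMSchwartz (L : Type) 6))
    (hpoly : ∀ G ∈ pinIsotypicPolys V S hGR η hW, ∀ f : FinSB ↥(maximalRealSubfield L) (Fin 6),
      (pinThetaDatum V S hGR η Γ).toThetaTop
          (piSchwartzBruhatEquiv (↥(maximalRealSubfield L)) (Fin 6)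
            (follandFock (cmBigFrame (L : Type) finProdFinEquiv (frameD V) (frameD_real V) (frameD_ne V) (dW S) (dW_real S)
              (dW_ne S) ι₁) G ⊗ₜ f)) ∈
        closure ((pinThetaDatum V S hGR η Γ).toThetaTop '' (M : Set (CMSchwartz (L : Type) 6))))
    (Φ : CMSchwartz (L : Type) 6)
    (hΦ : Φ ∈ (wmInputCM₂g V S hGR η hη hηc ι₁ V.sylvesterFrame (sylvesterFrame_formCongr V)).SK) :
    (pinThetaDatum V S hGR η Γ).toThetaTop Φ ∈
      closure ((pinThetaDatum V S hGR η Γ).toThetaTop '' (M : Set (CMSchwartz (L : Type) 6))) := by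
  -- the target closure is (the carrier of) a closed submodule of `ThetaTop`
  let Tℓ := toThetaTopₗ
    (cmPairRepTwist (L : Type) finProdFinEquiv (frameD V) (frameD_real V) (frameD_ne V) (dW S) (dW_real S) (dW_ne S) hGR η).toHomUnits Γ
  let Mc : Submodule ℂ (pinThetaDatum V S hGR η Γ).ThetaTop := (M.map Tℓ).topologicalClosure
  have hMc : (Mc : Set (pinThetaDatum V S hGR η Γ).ThetaTop) =
      closure ((pinThetaDatum V S hGR η Γ).toThetaTop '' (M : Set (CMSchwartz (L : Type) 6))) := by
    rw [Submodule.topologicalClosure_coe, Submodule.map_coe]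
    rfl
  rw [← hMc, SetLike.mem_coe]
  -- `Φ ∈ span {E (x ⊗ f) : x ∈ 𝒮_∞^κ}` (#57); `Mc` is a submodule and `toTop` is linear, so one pure tensor at a time
  have hmem := mem_span_tensor_of_mem_SK_wmInputCM₂g V S hGR η hη hηc ι₁ V.sylvesterFrame (sylvesterFrame_formCongr V) Φ hΦ
  suffices hle : (Submodule.span ℂ
      {Φ : CMSchwartz (L : Type) 6 | ∃ Φinf ∈ archSK V S hGR η ι₁ V.sylvesterFrame (sylvesterFrame_formCongr V),
        ∃ f : FinSB (↥(maximalRealSubfield L)) (Fin 6),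
          Φ = piSchwartzBruhatEquiv (↥(maximalRealSubfield L)) (Fin 6) (Φinf ⊗ₜ f)}).map Tℓ ≤ Mc from
    hle (Submodule.mem_map_of_mem hmem)
  rw [Submodule.map_span_le]
  rintro _ ⟨x, hxSK, f, rfl⟩
  -- one pure tensor: `Ψ ↦ toTop E(Ψ ⊗ f)` is continuous ((J-top) #7) and linear, and
  -- `x ∈ closure span (follandFock '' pinIsotypicPolys)` (#59)
  let g : SchwartzMap (Fin 6 → mixedEmbedding.mixedSpace (↥(maximalRealSubfield L))) ℂ →ₗ[ℂ]
      (pinThetaDatum V S hGR η Γ).ThetaTop :=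
    Tℓ ∘ₗ (piSchwartzBruhatEquiv (↥(maximalRealSubfield L)) (Fin 6)).toLinearMap ∘ₗ
      (TensorProduct.mk ℂ _ (FinSB ↥(maximalRealSubfield L) (Fin 6))).flip f
  have hg : ∀ Ψ, g Ψ = Tℓ (piSchwartzBruhatEquiv (↥(maximalRealSubfield L)) (Fin 6) (Ψ ⊗ₜ f)) := fun Ψ => rfl
  have hcont : Continuous g :=
    continuous_toThetaTop_cmPairRepTwist_tmul (L : Type) finProdFinEquiv (frameD V) (frameD_real V) (frameD_ne V) (dW S)
      (dW_real S) (dW_ne S) hGR η Γ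
      (hasThetaMajorants_cmPairRepTwist (L : Type) finProdFinEquiv (frameD V) (frameD_real V) (frameD_ne V) (dW S) (dW_real S)
        (dW_ne S) hGR η (hρ_of_dW_definite V S hGR hW) hηc) f
  have hxmem := mem_closure_span_follandFock_of_mem_archSK V S hGR η hW hxSK
  have h1 : g x ∈ closure (g '' _) := image_closure_subset_closure_image hcont ⟨_, hxmem, rfl⟩
  rw [← hg]
  refine (Submodule.isClosed_topologicalClosure (M.map Tℓ)).closure_subset_iff.mpr ?_ h1
  rintro _ ⟨Ψ, hΨ, rfl⟩
  change Ψ ∈ Submodule.span ℂ _ at hΨ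
  show g Ψ ∈ Mc
  induction hΨ using Submodule.span_induction with
  | mem y hy =>
      obtain ⟨G, hG, rfl⟩ := hy
      rw [← SetLike.mem_coe, hMc, hg]
      exact hpoly G hG f
  | zero => rw [map_zero]; exact Mc.zero_mem
  | add y z _ _ hy hz => rw [map_add]; exact Mc.add_mem hy hz
  | smul a y _ hy => rw [map_smul]; exact Mc.smul_mem a hy

end Val

/-! ## at the W pin of record, in the currency of #55's `hdense` -/

section Pin

variable {L : CMField} {ι₁ : L →+* ℂ} (V : HermSpace3 L ι₁) (S : StubTree.SeesawDatum L)
variable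
  (hGR : (cmSplittingDatum (L : Type) finProdFinEquiv (frameD V) (frameD_real V) (frameD_ne V) (dW S) (dW_real S) (dW_ne S)).CompatibleSplitting)
  (η : CMAdelic (L : Type) (frameD V) × CMAdelic (L : Type) (dW S) →* ℂˣ)
  (hη : ∀ γU ∈ CMRat (L : Type) (frameD V), ∀ γ ∈ CMRat (L : Type) (dW S), η (γU, γ) = 1)
  (hηc : Continuous fun p => ((η p : ℂˣ) : ℂ))
  (hW : (∀ j, 0 < (ι₁ (dW S j)).re) ∨ ∀ j, (ι₁ (dW S j)).re < 0)
  (jD : InfinitePlace (L : Type) → HodgeCM.PerL34.Fock.EqVar → Fin 6) (m₁ m₂ : InfinitePlace (L : Type) → ℤ)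
variable {σ : InfinitePlace (L : Type) → Equiv.Perm (Fin 2)}

include hW in
/-- **#55's `hdense` ⟸ the polynomial-level statement.**  At the W pin of record: if for every `G ∈ pinIsotypicPolys` and every
`f`, `toTop W₀ (E(follandFock 𝔢 G ⊗ f))` lies in the `Θ`-closure of the span of the inserted printed vectors `ins f φ`, then the
census field `dense` holds for EVERY `Φ ∈ W₀.SK` (the hypothesis `hdense` of `nonempty_hypCoreW₁₂_wmInputCM₂g`, verbatim). -/
theorem hdense_of_polys
    (hpoly : ∀ G ∈ pinIsotypicPolys V S hGR η hW, ∀ f : FinSB ↥(maximalRealSubfield L) (Fin 6),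
      toTop (wmInputCM₂g V S hGR η hη hηc ι₁ V.sylvesterFrame (sylvesterFrame_formCongr V))
          (piSchwartzBruhatEquiv (↥(maximalRealSubfield L)) (Fin 6)
            (follandFock (cmBigFrame (L : Type) finProdFinEquiv (frameD V) (frameD_real V) (frameD_ne V) (dW S) (dW_real S)
              (dW_ne S) ι₁) G ⊗ₜ f)) ∈
        closure (toTop (wmInputCM₂g V S hGR η hη hηc ι₁ V.sylvesterFrame (sylvesterFrame_formCongr V)) ''
          (Submodule.span ℂ (Set.range fun q : FinSB ↥(maximalRealSubfield L) (Fin 6) × (printedAtσ V S hW jD m₁ m₂ σ).F =>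
            ins (L : Type) (frameD V) (frameD_real V) (frameD_ne V) (dW S) (dW_real S) (dW_ne S) ι₁ (datumAtσ V S jD (jIOf V S hW) σ)
              m₁ m₂ q.1 q.2) : Set (CMSchwartz (L : Type) 6))))
    (Φ : CMSchwartz (L : Type) 6)
    (hΦ : Φ ∈ (wmInputCM₂g V S hGR η hη hηc ι₁ V.sylvesterFrame (sylvesterFrame_formCongr V)).SK) :
    toTop (wmInputCM₂g V S hGR η hη hηc ι₁ V.sylvesterFrame (sylvesterFrame_formCongr V)) Φ ∈
      closure (toTop (wmInputCM₂g V S hGR η hη hηc ι₁ V.sylvesterFrame (sylvesterFrame_formCongr V)) ''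
        (Submodule.span ℂ (Set.range fun q : FinSB ↥(maximalRealSubfield L) (Fin 6) × (printedAtσ V S hW jD m₁ m₂ σ).F =>
          ins (L : Type) (frameD V) (frameD_real V) (frameD_ne V) (dW S) (dW_real S) (dW_ne S) ι₁ (datumAtσ V S jD (jIOf V S hW) σ)
            m₁ m₂ q.1 q.2) : Set (CMSchwartz (L : Type) 6))) := by
  dsimp only [toTop, thetaTopOf] at hpoly ⊢
  rw [wmInputCM₂g_ρ_eq_of V S hGR η hη hηc ι₁ V.sylvesterFrame (sylvesterFrame_formCongr V) hW] at hpoly ⊢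
  exact dense_val_of_polys V S hGR η hη hηc hW _ _ hpoly Φ hΦ

end Pin

end HodgeCM.Model.HypCensus

end
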